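import Mathlib
import Summits.QuantumFields.YangMills.Theorems.CoarseStiffnessTailCappedCoarseStiffnessLPressureConvexity
import Literature.MathematicalPhysics.QuantumFieldTheory.Balaban1983to89.T4PairDerivBridge
import HarnessLib

/-!
# LINE 29 «CombPeierls» — stub (B) `stub_boxTailBookkeeping` PROVED: pinning + per-plaquette sub-Gaussian tails + first moments
# ⟹ the centred upper tail of a box observable (pure measure theory; no physics)

Seat `ym-line-cst-p1` (g33), `--supports stmt-QuantumFields-23532` (`PoincareLipschitz.MesoscopicConcentrationL`, K1′; skeleton
`Cruxes/HistoryTailL/Lines/comb_peierls.lean` of ideator `ym-r3-idea-2` g16).  The theorem below is the registered stub TOKEN FOR TOKEN.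
Under `μ_K = gibbsK F ℰp γ K` (a probability measure for `0 < γ`): if a measurable `g` is PINNED to a constant `g₁` by the plaquettes of a set
`S` — `|g(U) − g₁| ≤ M·δ` whenever every `p ∈ S` has `dist₁(U(∂p)) < δ` (`δ > 0`) — and every `p ∈ S` has the tail
`μ_K{s ≤ dist₁(U(∂p))} ≤ C₀e^{−κs²}` (`s ≥ 0`) and first moment `∫ dist₁(U(∂p)) ≤ m₁`, then for `r > 0` with `2·M·NS·m₁ ≤ r` (`#S ≤ NS`):
`μ_K{r ≤ g − ∫g} ≤ NS·C₀·exp(−κ(r/(2M))²)`.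

THE ARGUMENT (exactly the stub's docstring).
1. PINNING AT THE SUM (`abs_sub_le_mul_sum`): `|g(U) − g₁| ≤ M·Σ_{p∈S} dist₁(U(∂p))` for EVERY `U` — for each `a > M·Σ` the threshold
   `δ = a/M` is admissible (`dist₁(U(∂p)) ≤ Σ < δ`), so `|g(U) − g₁| ≤ a`; density of `ℝ`.  Hence `g` is bounded (`dist₁ ≤ 2` on `SU(2)`),
   so integrable, and CENTRING: `|∫g − g₁| ≤ ∫|g − g₁| ≤ M·Σ_{p∈S}∫dist₁ ≤ M·#S·m₁ ≤ M·NS·m₁ ≤ r/2`.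
2. STRICT PINNING BELOW THE THRESHOLD: if every `p ∈ S` has `dist₁(U(∂p)) < r/(2M)` then (finite maximum `δ₀ < r/(2M)`, threshold
   `δ = (δ₀ + r/(2M))/2`) `|g(U) − g₁| ≤ M·δ < r/2`, so `g(U) − ∫g ≤ |g(U) − g₁| + |∫g − g₁| < r/2 + r/2 = r`.  Contrapositive:
   `{r ≤ g − ∫g} ⊆ ⋃_{p∈S} {r/(2M) ≤ dist₁(U(∂p))}`.
3. UNION BOUND (Mathlib `measureReal_biUnion_finset_le`) and the tails at `s = r/(2M) ≥ 0`: `≤ #S·C₀·e^{−κ(r/(2M))²} ≤ NS·C₀·e^{−κ(r/(2M))²}`.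

HONEST SCOPE.  Bookkeeping only; nothing of the line's stubs (P) (landed separately, ✓`PoincareLipschitzMesoscopicConcentrationLUniformPlaquetteTail`),
(D), (R), of `MesoscopicConcentrationL` (23532), `HistoryTailL` (19936) or rung R3 (`YM3TorusSU2`, a RECORD rung — not d = 4, not infinite
volume, not a mass gap, not Clay) is proved here.

References: M. Ledoux, *The concentration of measure phenomenon*, AMS (2001), §1.1 (union/centring bookkeeping) [Ledoux2001];
Mathlib `MeasureTheory.measureReal_biUnion_finset_le`.
-/

noncomputable section

namespace Summit.QuantumFields.YangMills.Theorems.PoincareLipschitzMesoscopicConcentrationLBoxTailBookkeeping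

open MeasureTheory ProbabilityTheory Finset
open Literature.MathematicalPhysics.QuantumFieldTheory
open Literature.MathematicalPhysics.QuantumFieldTheory.Balaban1983to89
open Literature.MathematicalPhysics.QuantumFieldTheory.Balaban1983to89.T3ContinuumYM3Torus
open Literature.MathematicalPhysics.QuantumFieldTheory.Balaban1983to89.T3UnitScaleTilt
open Literature.MathematicalPhysics.QuantumFieldTheory.Balaban1983to89.T3UnitLawDensityEML (ℰp)
open Summit.QuantumFields.YangMills.Theorems.CoarseStiffnessTailPressureConvexity (measurable_dist1_plaqHol)
open Literature.MathematicalPhysics.QuantumFieldTheory.Balaban1983to89.T4PairDerivBridge (dist1_le_two_specialUnitaryGroup)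

/-! ## §1 Pinning at the sum of the plaquette deviations -/

section Pinning

variable (F : T3Family)

/-- **Pinning at the sum**: if `|g(U) − g₁| ≤ M·δ` whenever all plaquettes of `S` are `δ`-small (`δ > 0`, `M > 0`), then for EVERY `U`
`|g(U) − g₁| ≤ M·Σ_{p ∈ T} dist₁(U(∂p))` for any finset `T ⊇ S` (density of `ℝ`: every `a > M·Σ` is an admissible `M·δ`). [folklore] -/
theorem abs_sub_le_mul_sum (K : ℕ) {S : Set (Plaq (F.P K) 0)} {T : Finset (Plaq (F.P K) 0)} (hST : ∀ p ∈ S, p ∈ T)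
    {g : GaugeField (F.P K) 0 (Matrix.specialUnitaryGroup (Fin 2) ℂ) → ℝ} {g₁ M : ℝ} (hM : 0 < M)
    (hpin : ∀ (U : GaugeField (F.P K) 0 (Matrix.specialUnitaryGroup (Fin 2) ℂ)) (δ : ℝ), 0 < δ → PlaqSmallOn S δ U → |g U - g₁| ≤ M * δ)
    (U : GaugeField (F.P K) 0 (Matrix.specialUnitaryGroup (Fin 2) ℂ)) :
    |g U - g₁| ≤ M * ∑ p ∈ T, GaugeGroup.dist1 (GaugeField.plaqHol U p) := by
  refine le_of_forall_gt_imp_ge_of_dense fun a ha => ?_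
  have hsum0 : 0 ≤ ∑ p ∈ T, GaugeGroup.dist1 (GaugeField.plaqHol U p) :=
    Finset.sum_nonneg fun p _ => GaugeGroup.dist1_nonneg _
  have ha0 : 0 < a := lt_of_le_of_lt (mul_nonneg hM.le hsum0) ha
  have hδ : 0 < a / M := div_pos ha0 hM
  have hsumlt : ∑ p ∈ T, GaugeGroup.dist1 (GaugeField.plaqHol U p) < a / M := by
    rw [lt_div_iff₀ hM]; linarith
  have hsmall : PlaqSmallOn S (a / M) U := by
    intro p hp
    have h1 : GaugeGroup.dist1 (GaugeField.plaqHol U p) ≤ ∑ q ∈ T, GaugeGroup.dist1 (GaugeField.plaqHol U q) :=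
      Finset.single_le_sum (f := fun q => GaugeGroup.dist1 (GaugeField.plaqHol U q))
        (fun q _ => GaugeGroup.dist1_nonneg _) (hST p hp)
    exact lt_of_le_of_lt h1 hsumlt
  calc |g U - g₁| ≤ M * (a / M) := hpin U (a / M) hδ hsmall
    _ = a := by field_simp

end Pinning

/-! ## §2 The registered stub BY NAME AND SIGNATURE -/

/-- **stub_boxTailBookkeeping (LINE 29 «CombPeierls», stub (B)), PROVED — token-identical with the registered stub of
`Cruxes/HistoryTailL/Lines/comb_peierls.lean` (crux stmt-QuantumFields-23532).**  Under `μ_K = gibbsK` (a probability measure): if a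
measurable `g` is pinned to a constant `g₁` by the plaquettes of a set `S` — `|g(U) − g₁| ≤ M·δ` whenever all `p ∈ S` are `δ`-small — and every
`p ∈ S` has the sub-Gaussian tail `μ_K{s ≤ dist₁(U(∂p))} ≤ C₀e^{−κs²}` and first moment `≤ m₁`, then for `r ≥ 2·M·NS·m₁` (`NS ≥ #S`), `r > 0`:
`μ_K{r ≤ g − ∫g} ≤ NS·C₀·exp(−κ(r/(2M))²)`.  Proof: pinning at the sum (`abs_sub_le_mul_sum`) ⇒ `g` bounded, integrable, centring
`|∫g − g₁| ≤ M·NS·m₁ ≤ r/2`; strict pinning below the threshold (finite maximum) ⇒ `{r ≤ g − ∫g} ⊆ ⋃_{p∈S}{r/(2M) ≤ dist₁}`; union bound.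
[cite: Ledoux2001, §1.1] -/
theorem stub_boxTailBookkeeping :
    ∀ (F : T3Family) (γ : ℝ), 0 < γ → ∀ (K : ℕ) (S : Set (Plaq (F.P K) 0)) (NS : ℝ)
      (g : GaugeField (F.P K) 0 (Matrix.specialUnitaryGroup (Fin 2) ℂ) → ℝ) (g₁ M C₀ κ m₁ : ℝ),
      Measurable g → 0 < M → 0 ≤ C₀ → 0 < κ → 0 ≤ m₁ → (S.ncard : ℝ) ≤ NS →
      (∀ (U : GaugeField (F.P K) 0 (Matrix.specialUnitaryGroup (Fin 2) ℂ)) (δ : ℝ), 0 < δ → PlaqSmallOn S δ U → |g U - g₁| ≤ M * δ) →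
      (∀ p ∈ S, ∀ s : ℝ, 0 ≤ s →
        (gibbsK F ℰp γ K).real {U | s ≤ GaugeGroup.dist1 (GaugeField.plaqHol U p)} ≤ C₀ * Real.exp (-(κ * s ^ 2))) →
      (∀ p ∈ S, ∫ U, GaugeGroup.dist1 (GaugeField.plaqHol U p) ∂(gibbsK F ℰp γ K) ≤ m₁) →
      ∀ r : ℝ, 0 < r → 2 * (M * NS * m₁) ≤ r →
        (gibbsK F ℰp γ K).real {U | r ≤ g U - ∫ V, g V ∂(gibbsK F ℰp γ K)} ≤ NS * C₀ * Real.exp (-(κ * (r / (2 * M)) ^ 2)) := by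
  intro F γ hγ K S NS g g₁ M C₀ κ m₁ hgm hM hC₀ _hκ hm₁ hNS hpin htail hmom r hr hrM
  haveI := isProbabilityMeasure_gibbsK F ℰp hγ.le K
  set μ := gibbsK F ℰp γ K with hμ
  -- the finite set of pinning plaquettes
  have hSfin : S.Finite := S.toFinite
  set T : Finset (Plaq (F.P K) 0) := hSfin.toFinset with hTdef
  have hmemT : ∀ p, p ∈ T ↔ p ∈ S := fun p => Set.Finite.mem_toFinset hSfin
  have hST : ∀ p ∈ S, p ∈ T := fun p hp => (hmemT p).2 hp
  have hcardT : (T.card : ℝ) ≤ NS := by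
    rw [hTdef, ← Set.ncard_eq_toFinset_card S hSfin]; exact hNS
  -- the plaquette deviations
  have hd0 : ∀ (p : Plaq (F.P K) 0) (U : GaugeField (F.P K) 0 (Matrix.specialUnitaryGroup (Fin 2) ℂ)),
      0 ≤ GaugeGroup.dist1 (GaugeField.plaqHol U p) := fun p U => GaugeGroup.dist1_nonneg _
  have hd2 : ∀ (p : Plaq (F.P K) 0) (U : GaugeField (F.P K) 0 (Matrix.specialUnitaryGroup (Fin 2) ℂ)),
      GaugeGroup.dist1 (GaugeField.plaqHol U p) ≤ 2 := fun p U => dist1_le_two_specialUnitaryGroup _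
  have hdi : ∀ p : Plaq (F.P K) 0, Integrable (fun U : GaugeField (F.P K) 0 (Matrix.specialUnitaryGroup (Fin 2) ℂ) =>
      GaugeGroup.dist1 (GaugeField.plaqHol U p)) μ := fun p =>
    (integrable_const (2 : ℝ)).mono' (measurable_dist1_plaqHol F K p).aestronglyMeasurable
      (ae_of_all _ fun U => by rw [Real.norm_eq_abs, abs_of_nonneg (hd0 p U)]; exact hd2 p U)
  -- §1: pinning at the sum, boundedness, integrability
  have hpinSum : ∀ U, |g U - g₁| ≤ M * ∑ p ∈ T, GaugeGroup.dist1 (GaugeField.plaqHol U p) :=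
    abs_sub_le_mul_sum F K hST hM hpin
  have hsum2 : ∀ U : GaugeField (F.P K) 0 (Matrix.specialUnitaryGroup (Fin 2) ℂ),
      ∑ p ∈ T, GaugeGroup.dist1 (GaugeField.plaqHol U p) ≤ 2 * (T.card : ℝ) := fun U => by
    calc ∑ p ∈ T, GaugeGroup.dist1 (GaugeField.plaqHol U p) ≤ ∑ _p ∈ T, (2 : ℝ) := Finset.sum_le_sum fun p _ => hd2 p U
      _ = 2 * (T.card : ℝ) := by rw [Finset.sum_const, nsmul_eq_mul]; ring
  have hgb : ∀ U, |g U| ≤ |g₁| + M * (2 * (T.card : ℝ)) := fun U => by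
    have h1 : |g U| ≤ |g₁| + |g U - g₁| := by
      have := abs_sub_abs_le_abs_sub (g U) g₁; linarith
    have h2 : |g U - g₁| ≤ M * (2 * (T.card : ℝ)) := (hpinSum U).trans (mul_le_mul_of_nonneg_left (hsum2 U) hM.le)
    linarith
  have hgi : Integrable g μ :=
    (integrable_const (|g₁| + M * (2 * (T.card : ℝ)))).mono' hgm.aestronglyMeasurable
      (ae_of_all _ fun U => by rw [Real.norm_eq_abs]; exact hgb U)
  -- centring
  have hcen : |(∫ V, g V ∂μ) - g₁| ≤ M * NS * m₁ := by
    have h1 : (∫ V, g V ∂μ) - g₁ = ∫ V, (g V - g₁) ∂μ := by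
      rw [integral_sub hgi (integrable_const _), integral_const, smul_eq_mul, probReal_univ, one_mul]
    rw [h1]
    have hsumi : Integrable (fun V : GaugeField (F.P K) 0 (Matrix.specialUnitaryGroup (Fin 2) ℂ) =>
        M * ∑ p ∈ T, GaugeGroup.dist1 (GaugeField.plaqHol V p)) μ :=
      (integrable_finsetSum T fun p _ => hdi p).const_mul M
    calc |∫ V, (g V - g₁) ∂μ| ≤ ∫ V, |g V - g₁| ∂μ := abs_integral_le_integral_abs
      _ ≤ ∫ V, M * ∑ p ∈ T, GaugeGroup.dist1 (GaugeField.plaqHol V p) ∂μ :=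
          integral_mono (hgi.sub (integrable_const _)).abs hsumi fun V => hpinSum V
      _ = M * ∑ p ∈ T, ∫ V, GaugeGroup.dist1 (GaugeField.plaqHol V p) ∂μ := by
          rw [integral_const_mul, integral_finsetSum T fun p _ => hdi p]
      _ ≤ M * ∑ _p ∈ T, m₁ :=
          mul_le_mul_of_nonneg_left (Finset.sum_le_sum fun p hp => hmom p ((hmemT p).1 hp)) hM.le
      _ = M * ((T.card : ℝ) * m₁) := by rw [Finset.sum_const, nsmul_eq_mul]
      _ ≤ M * (NS * m₁) := mul_le_mul_of_nonneg_left (mul_le_mul_of_nonneg_right hcardT hm₁) hM.le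
      _ = M * NS * m₁ := by ring
  -- §2: the event lies in the union of the plaquette tails at threshold `r/(2M)`
  have hr2M : 0 < r / (2 * M) := by positivity
  have hsub : {U | r ≤ g U - ∫ V, g V ∂μ} ⊆
      ⋃ p ∈ T, {U : GaugeField (F.P K) 0 (Matrix.specialUnitaryGroup (Fin 2) ℂ) |
        r / (2 * M) ≤ GaugeGroup.dist1 (GaugeField.plaqHol U p)} := by
    intro U hU
    simp only [Set.mem_setOf_eq] at hU
    by_contra hnot
    simp only [Set.mem_iUnion, Set.mem_setOf_eq, not_exists, not_le] at hnot
    -- strict pinning: `|g U - g₁| < r/2`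
    have hlt : |g U - g₁| < r / 2 := by
      by_cases hT0 : T.Nonempty
      · set δ₀ : ℝ := T.sup' hT0 (fun p => GaugeGroup.dist1 (GaugeField.plaqHol U p)) with hδ₀
        have hδ₀lt : δ₀ < r / (2 * M) := by
          rw [hδ₀, Finset.sup'_lt_iff]
          exact fun p hp => hnot p hp
        obtain ⟨p0, hp0⟩ := hT0
        have hδ₀ge : 0 ≤ δ₀ :=
          (hd0 p0 U).trans (Finset.le_sup' (fun p => GaugeGroup.dist1 (GaugeField.plaqHol U p)) hp0)
        set δ : ℝ := (δ₀ + r / (2 * M)) / 2 with hδ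
        have hδpos : 0 < δ := by rw [hδ]; linarith
        have hδlt : δ < r / (2 * M) := by rw [hδ]; linarith
        have hδ₀δ : δ₀ < δ := by rw [hδ]; linarith
        have hsm : PlaqSmallOn S δ U := fun p hp =>
          lt_of_le_of_lt (Finset.le_sup' (fun p => GaugeGroup.dist1 (GaugeField.plaqHol U p)) (hST p hp)) hδ₀δ
        calc |g U - g₁| ≤ M * δ := hpin U δ hδpos hsm
          _ < M * (r / (2 * M)) := mul_lt_mul_of_pos_left hδlt hM
          _ = r / 2 := by field_simp
      · have hTe : T = ∅ := Finset.not_nonempty_iff_eq_empty.mp hT0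
        have hsm : PlaqSmallOn S (r / (4 * M)) U := by
          intro p hp
          have := hST p hp
          rw [hTe] at this
          exact absurd this (Finset.notMem_empty p)
        calc |g U - g₁| ≤ M * (r / (4 * M)) := hpin U (r / (4 * M)) (by positivity) hsm
          _ = r / 4 := by field_simp
          _ < r / 2 := by linarith
    have h2 := le_abs_self (g U - g₁)
    have h3 := neg_abs_le ((∫ V, g V ∂μ) - g₁)
    have : g U - ∫ V, g V ∂μ < r := by
      have h1 : g U - ∫ V, g V ∂μ = (g U - g₁) - ((∫ V, g V ∂μ) - g₁) := by ring
      rw [h1]; linarith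
    linarith
  -- §3: union bound and the tails at `s = r/(2M) ≥ 0`
  have hexp0 : 0 ≤ C₀ * Real.exp (-(κ * (r / (2 * M)) ^ 2)) := by positivity
  calc μ.real {U | r ≤ g U - ∫ V, g V ∂μ}
      ≤ μ.real (⋃ p ∈ T, {U : GaugeField (F.P K) 0 (Matrix.specialUnitaryGroup (Fin 2) ℂ) |
          r / (2 * M) ≤ GaugeGroup.dist1 (GaugeField.plaqHol U p)}) := measureReal_mono hsub (measure_ne_top _ _)
    _ ≤ ∑ p ∈ T, μ.real {U : GaugeField (F.P K) 0 (Matrix.specialUnitaryGroup (Fin 2) ℂ) |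
          r / (2 * M) ≤ GaugeGroup.dist1 (GaugeField.plaqHol U p)} := measureReal_biUnion_finset_le T _
    _ ≤ ∑ _p ∈ T, C₀ * Real.exp (-(κ * (r / (2 * M)) ^ 2)) :=
        Finset.sum_le_sum fun p hp => htail p ((hmemT p).1 hp) _ hr2M.le
    _ = (T.card : ℝ) * (C₀ * Real.exp (-(κ * (r / (2 * M)) ^ 2))) := by rw [Finset.sum_const, nsmul_eq_mul]
    _ ≤ NS * (C₀ * Real.exp (-(κ * (r / (2 * M)) ^ 2))) := mul_le_mul_of_nonneg_right hcardT hexp0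
    _ = NS * C₀ * Real.exp (-(κ * (r / (2 * M)) ^ 2)) := by ring

end Summit.QuantumFields.YangMills.Theorems.PoincareLipschitzMesoscopicConcentrationLBoxTailBookkeeping

end
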